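import Summits.AtomisticToContinuum.HydrodynamicLimit.Theorems.DenseExcursion.Negative.CompressionBudget
import Summits.AtomisticToContinuum.HydrodynamicLimit.Theorems.ImplosionDichotomyHsEosLowDensity
import Summits.AtomisticToContinuum.HydrodynamicLimit.Theorems.ImplosionDichotomyPolynomialCompressionUniquenessPrimitive
import Summits.AtomisticToContinuum.HydrodynamicLimit.Theorems.ImplosionDichotomyPolynomialCompressionUniqueness

/-!
# Entropy transport along classical hard-sphere-Euler solutions, with a transport minimum principle

Negative-knowledge infrastructure for the crux `ImplosionDichotomy.DenseExcursion` (stmt-AtomisticToContinuum-12586),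
from the standing disprover's `Cruxes/DenseExcursion/Disproof.lean` §14 (gen 4). The EOS wall is down: the route's
support item `HsEosLowDensity` (stmt-0768) is the tree theorem `hsEosLowDensity_proof`, so the hard-sphere excess free
energy agrees on `[0, η₀)` with a function `F` analytic on `(-η₀, η₀)` (`eos_package`). Consequently, along every
classical solution `IsHardSphereEulerSolution σ T ρ u θ` with `σ > 0` whose packing `ρσ³` stays `< η₀`, the typed
pressure IS `ρ θ ζ_σ(ρ)` with `ζ_σ(r) = 1 + rσ³F′(rσ³)` smooth (`pressure_eq`, `contDiffOn_zetaOf`), the primitive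
equations of `…UniquenessPrimitive` apply, and the SPECIFIC ENTROPY `s = (3/2) log θ - log ρ - F(ρσ³)` is transported:
`∂ₜs = -u·∇s` pointwise (`entropy_transport` — the Gibbs relation `Z = 1 + ηF′(η)` is exactly what cancels the
compression terms). Second part (EOS-free, velocity-free): if ANY jointly smooth scalar `S` on `[0, T) × 𝕋³` obeys
a transport identity `∂ₜS = -∑ᵢ uᵢ ∂ᵢS`, then `min S(0,·) ≤ S(t,x) ≤ max S(0,·)` (`transport_min_principle`,
`transport_max_principle`: first-touch argument on `S + Lt` at the first bad time — a closed set, projection of a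
compact sublevel set of the continuous lift — and a spatial minimum point, where `∂ₜS = 0` by Fermat; then `L ↓ 0`;
the Fermat / one-sided-derivative lemmas of `Negative/CompressionBudget.lean` are reused). Hence
`min s(0,·) ≤ s(t,x) ≤ max s(0,·)` along dilute classical solutions (`exists_ent_zero_le`, `exists_ent_le_zero`).
The quantitative consequences for ADMISSIBLE solutions (hot spots `θ³ ≥ cρ²`, dense volume `O(σ⁵)`, no excursion at
bounded temperature) are in `Negative/EntropyBudget.lean`. refuter-cdisprove-stmt-AtomisticToContinuum-12586-g4-0.
-/

noncomputable section

namespace Summit.AtomisticToContinuum.HydrodynamicLimit.Theorems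

open MeasureTheory Filter Set Topology
open scoped ENNReal InnerProductSpace ContDiff
open Literature.MathematicalPhysics.KineticTheory Literature.Analysis.FluidPDE
open Literature.Analysis.FunctionSpaces

namespace DenseExcursionEntropyBudget

/-- **The EOS package, now a THEOREM of the tree** (`hsEosLowDensity_proof`, stmt-0768): `η₀ > 0` and `F` analytic on
`(-η₀, η₀)` with `hsExcessFreeEnergy = F` on `[0, η₀)` and `F 0 = 0`. [folklore] -/
theorem eos_package : ∃ η₀ : ℝ, 0 < η₀ ∧ ∃ F : ℝ → ℝ, AnalyticOnNhd ℝ F (Ioo (-η₀) η₀) ∧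
    EqOn hsExcessFreeEnergy F (Ico 0 η₀) ∧ F 0 = 0 := by
  obtain ⟨η₀, hη₀, F, hF, hEq, h0, -, -⟩ := hsEosLowDensity_proof
  exact ⟨η₀, hη₀, F, hF, hEq, h0⟩

/-- The compressibility factor as a function of the DENSITY at reduced diameter `σ`, through the analytic free
energy `F`: `ζ_σ(r) = 1 + r σ³ F′(r σ³)` (`= Z(rσ³)` on the packing range `(0, η₀)`). -/
def zetaOf (σ : ℝ) (F : ℝ → ℝ) (r : ℝ) : ℝ :=
  1 + r * σ ^ 3 * deriv F (r * σ ^ 3)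

/-- The SPECIFIC ENTROPY of the hard-sphere gas along fields `(ρ, θ)` at reduced diameter `σ` (per particle, up to an
additive constant): `s = (3/2) log θ - log ρ - F(ρσ³)` (ideal monatomic part plus the athermal excess `-F`). -/
def ent (σ : ℝ) (F : ℝ → ℝ) (ρ θ : ℝ → T3 → ℝ) (t : ℝ) (y : T3) : ℝ :=
  3 / 2 * Real.log (θ t y) - Real.log (ρ t y) - F (ρ t y * σ ^ 3)

section Transport

variable {σ T η₀ : ℝ} {F : ℝ → ℝ} {ρ θ : ℝ → T3 → ℝ} {u : ℝ → T3 → V3}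

/-- The density range `{r | rσ³ ∈ (-η₀, η₀)}` is open. [folklore] -/
theorem isOpen_densityRange (σ η₀ : ℝ) : IsOpen {r : ℝ | r * σ ^ 3 ∈ Ioo (-η₀) η₀} :=
  isOpen_Ioo.preimage (continuous_id.mul continuous_const)

/-- `ζ_σ` is smooth on the density range. [folklore] -/
theorem contDiffOn_zetaOf (hF : AnalyticOnNhd ℝ F (Ioo (-η₀) η₀)) (σ : ℝ) :
    ContDiffOn ℝ ∞ (zetaOf σ F) {r : ℝ | r * σ ^ 3 ∈ Ioo (-η₀) η₀} := by
  have h1 : ContDiffOn ℝ ∞ (fun r : ℝ => r * σ ^ 3) {r : ℝ | r * σ ^ 3 ∈ Ioo (-η₀) η₀} :=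
    (contDiffOn_id.mul contDiffOn_const)
  have h2 : ContDiffOn ℝ ∞ (deriv F) (Ioo (-η₀) η₀) := hF.deriv.contDiffOn_of_completeSpace
  exact contDiffOn_const.add (h1.mul (h2.comp h1 fun r hr => hr))

/-- Along a classical solution with `σ > 0` and packing `< η₀`, the density takes values in the density range.
[folklore] -/
theorem density_mem_range (hσ : 0 < σ) (hE : IsHardSphereEulerSolution σ T ρ u θ)
    (hpack : ∀ t ∈ Ico 0 T, ∀ x, ρ t x * σ ^ 3 < η₀) :
    ∀ t ∈ Ico 0 T, ∀ x, ρ t x ∈ {r : ℝ | r * σ ^ 3 ∈ Ioo (-η₀) η₀} := by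
  intro t ht x
  have hpos : 0 < ρ t x * σ ^ 3 := mul_pos (hE.density_pos t ht x) (pow_pos hσ 3)
  have hlt := hpack t ht x
  exact ⟨by linarith, hlt⟩

/-- Along a classical solution with `σ > 0` and packing `< η₀`, the typed pressure IS `ρ θ ζ_σ(ρ)`
(`hsCompressibility = 1 + η F′(η)` on `(0, η₀)`). [folklore] -/
theorem pressure_eq (hEq : EqOn hsExcessFreeEnergy F (Ico 0 η₀)) (hσ : 0 < σ)
    (hE : IsHardSphereEulerSolution σ T ρ u θ) (hpack : ∀ t ∈ Ico 0 T, ∀ x, ρ t x * σ ^ 3 < η₀) :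
    ∀ t ∈ Ico 0 T, ∀ x, hsPressure σ (ρ t x) (θ t x) = ρ t x * θ t x * zetaOf σ F (ρ t x) := by
  intro t ht x
  have hpos : 0 < ρ t x * σ ^ 3 := mul_pos (hE.density_pos t ht x) (pow_pos hσ 3)
  unfold hsPressure zetaOf
  rw [hsCompressibility_eq_of_eqOn hEq ⟨hpos, hpack t ht x⟩]

/-- **ENTROPY TRANSPORT.** Along every classical hard-sphere-Euler solution with `σ > 0` whose packing stays below the
analyticity threshold `η₀` of the equation of state, the specific entropy `s = (3/2) log θ - log ρ - F(ρσ³)` is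
transported: `∂ₜ s = -u · ∇s` pointwise on `[0, T) × 𝕋³` (primitive mass and temperature equations + the Gibbs
relation `Z = 1 + η F′(η)`). [folklore] -/
theorem entropy_transport (hF : AnalyticOnNhd ℝ F (Ioo (-η₀) η₀)) (hEq : EqOn hsExcessFreeEnergy F (Ico 0 η₀))
    (hσ : 0 < σ) (hE : IsHardSphereEulerSolution σ T ρ u θ)
    (hpack : ∀ t ∈ Ico 0 T, ∀ x, ρ t x * σ ^ 3 < η₀) {t : ℝ} (ht : t ∈ Ico 0 T) (x : T3) :
    Torus.timeDerivWithin (Ico 0 T) (ent σ F ρ θ) t x =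
      -∑ i, u t x i * Torus.partialDeriv i (ent σ F ρ θ t) x := by
  have hU : UniqueDiffOn ℝ (Ico (0 : ℝ) T) := uniqueDiffOn_Ico 0 T
  have hJ := isOpen_densityRange σ η₀
  have hζ := contDiffOn_zetaOf hF σ
  have hρJ := density_mem_range hσ hE hpack
  have hp := pressure_eq hEq hσ hE hpack
  have hρ1 : Torus.IsContDiff 1 (ρ t) := (hE.smooth_density.isSmooth_slice ht).isContDiff (by simp)
  have hθ1 : Torus.IsContDiff 1 (θ t) := (hE.smooth_temperature.isSmooth_slice ht).isContDiff (by simp)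
  have hρne : ρ t x ≠ 0 := (hE.density_pos t ht x).ne'
  have hθne : θ t x ≠ 0 := (hE.temperature_pos t ht x).ne'
  have hmem : ρ t x * σ ^ 3 ∈ Ioo (-η₀) η₀ := hρJ t ht x
  have hFd : HasDerivAt F (deriv F (ρ t x * σ ^ 3)) (ρ t x * σ ^ 3) :=
    ((hF _ hmem).differentiableAt).hasDerivAt
  -- time-slice derivatives
  have sρ := hE.smooth_density.hasDerivWithinAt_slice ht x
  have sθ := hE.smooth_temperature.hasDerivWithinAt_slice ht x
  have hA : Torus.timeDerivWithin (Ico 0 T) (ent σ F ρ θ) t x =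
      3 / 2 * (Torus.timeDerivWithin (Ico 0 T) θ t x / θ t x) -
        Torus.timeDerivWithin (Ico 0 T) ρ t x / ρ t x -
        deriv F (ρ t x * σ ^ 3) * (Torus.timeDerivWithin (Ico 0 T) ρ t x * σ ^ 3) := by
    refine timeDerivWithin_eq_of_hasDerivWithinAt (F := ent σ F ρ θ) ?_ (hU t ht)
    show HasDerivWithinAt (fun τ => 3 / 2 * Real.log (θ τ x) - Real.log (ρ τ x) - F (ρ τ x * σ ^ 3)) _ _ _
    exact (((sθ.log hθne).const_mul (3 / 2)).sub (sρ.log hρne)).sub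
      (hFd.comp_hasDerivWithinAt t (sρ.mul_const (σ ^ 3)))
  -- coordinate-line derivatives
  have cρ := fun i => hasDerivAt_coordLine hρ1 x i
  have cθ := fun i => hasDerivAt_coordLine hθ1 x i
  have hB : ∀ i : Fin 3, Torus.partialDeriv i (ent σ F ρ θ t) x =
      3 / 2 * (Torus.partialDeriv i (θ t) x / θ t x) - Torus.partialDeriv i (ρ t) x / ρ t x -
        deriv F (ρ t x * σ ^ 3) * (Torus.partialDeriv i (ρ t) x * σ ^ 3) := by
    intro i
    have hθne' : θ t (x + Torus.proj ((0 : ℝ) • EuclideanSpace.single i (1 : ℝ))) ≠ 0 := by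
      simpa only [zero_smul, Torus.proj_zero, add_zero] using hθne
    have hρne' : ρ t (x + Torus.proj ((0 : ℝ) • EuclideanSpace.single i (1 : ℝ))) ≠ 0 := by
      simpa only [zero_smul, Torus.proj_zero, add_zero] using hρne
    have hFd' : HasDerivAt F (deriv F (ρ t x * σ ^ 3))
        (ρ t (x + Torus.proj ((0 : ℝ) • EuclideanSpace.single i (1 : ℝ))) * σ ^ 3) := by
      simpa only [zero_smul, Torus.proj_zero, add_zero] using hFd
    refine partialDeriv_eq_of_hasDerivAt (F := ent σ F ρ θ t) ?_
    show HasDerivAt (fun s : ℝ => 3 / 2 * Real.log (θ t (x + Torus.proj (s • EuclideanSpace.single i (1 : ℝ)))) -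
      Real.log (ρ t (x + Torus.proj (s • EuclideanSpace.single i (1 : ℝ)))) -
      F (ρ t (x + Torus.proj (s • EuclideanSpace.single i (1 : ℝ))) * σ ^ 3)) _ 0
    have h := ((((cθ i).log hθne').const_mul (3 / 2)).sub ((cρ i).log hρne')).sub
      (hFd'.comp (0 : ℝ) ((cρ i).mul_const (σ ^ 3)))
    refine h.congr_deriv ?_
    simp only [zero_smul, Torus.proj_zero, add_zero]
  have hP1 := hsEuler_density_eq hE ht x
  have hP3 := hsEuler_temperature_eq hE hJ hζ hρJ hp ht x
  rw [hA]
  simp only [hB]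
  rw [hP1, hP3]
  simp only [Fin.sum_univ_three, zetaOf]
  field_simp
  ring

end Transport

/-! ### A minimum / maximum principle for transported scalars (EOS-free, velocity-free) -/

section MinPrinciple

/-- **Fermat on the torus, minimum version**: at a spatial minimum point every partial derivative vanishes.
[folklore] -/
theorem partialDeriv_eq_zero_of_isMinOn {f : T3 → ℝ} {x : T3} (hx : IsMinOn f univ x) (i : Fin 3) :
    Torus.partialDeriv i f x = 0 := by
  unfold Torus.partialDeriv Torus.lineDeriv
  apply IsLocalMin.deriv_eq_zero
  refine Filter.Eventually.of_forall fun s => ?_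
  have h := hx (mem_univ (x + Torus.proj (s • EuclideanSpace.single i (1 : ℝ))))
  simpa using h

/-- A minimum from the left forces a non-positive derivative. [folklore] -/
theorem deriv_nonpos_of_left_min {φ : ℝ → ℝ} {φ' t : ℝ} (hφ : HasDerivAt φ φ' t)
    (hmin : ∀ᶠ s in 𝓝[<] t, φ t ≤ φ s) : φ' ≤ 0 := by
  have h := DenseExcursionCompressionBudget.deriv_nonneg_of_left_max hφ.neg
    (by filter_upwards [hmin] with s hs using neg_le_neg hs)
  linarith

/-- The set of times in `[0, t₁]` at which a space–time field with continuous lift reaches the level `≥ c` somewhere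
is closed (projection of a compact superlevel set). [folklore] -/
theorem isClosed_setOf_exists_ge {G : ℝ → T3 → ℝ} {t₁ : ℝ}
    (hG : ContinuousOn (Torus.stLift G) (Icc 0 t₁ ×ˢ univ)) (c : ℝ) :
    IsClosed {t | t ∈ Icc 0 t₁ ∧ ∃ x, c ≤ G t x} := by
  set Q : Set (EuclideanSpace ℝ (Fin 3)) :=
    (WithLp.toLp 2) '' (Set.pi univ fun _ : Fin 3 => Icc (0 : ℝ) 1) with hQ
  have hQc : IsCompact Q := Torus.isCompact_toLp_image_pi_Icc
  have hGc : ContinuousOn (Torus.stLift G) (Icc 0 t₁ ×ˢ Q) := hG.mono (prod_mono le_rfl (subset_univ _))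
  have hSclosed : IsClosed ((Icc 0 t₁ ×ˢ Q) ∩ Torus.stLift G ⁻¹' Ici c) :=
    hGc.preimage_isClosed_of_isClosed (isClosed_Icc.prod hQc.isClosed) isClosed_Ici
  have hSc : IsCompact ((Icc 0 t₁ ×ˢ Q) ∩ Torus.stLift G ⁻¹' Ici c) :=
    (isCompact_Icc.prod hQc).of_isClosed_subset hSclosed inter_subset_left
  have hAeq : {t | t ∈ Icc 0 t₁ ∧ ∃ x, c ≤ G t x} =
      Prod.fst '' ((Icc 0 t₁ ×ˢ Q) ∩ Torus.stLift G ⁻¹' Ici c) := by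
    ext t
    constructor
    · rintro ⟨ht, x, hx⟩
      refine ⟨(t, Torus.repr x), ⟨mk_mem_prod ht (Torus.repr_mem_toLp_image_pi_Icc x), ?_⟩, rfl⟩
      show c ≤ Torus.stLift G (t, Torus.repr x)
      simpa [Torus.stLift_apply, Torus.proj_repr] using hx
    · rintro ⟨⟨s, y'⟩, ⟨hsy, hGy⟩, rfl⟩
      refine ⟨(mem_prod.1 hsy).1, Torus.proj y', ?_⟩
      have : c ≤ Torus.stLift G (s, y') := hGy
      simpa [Torus.stLift_apply] using this
  rw [hAeq]
  exact (hSc.image continuous_fst).isClosed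

/-- The set of times in `[0, t₁]` at which a space–time field with continuous lift reaches the level `≤ c` somewhere
is closed. [folklore] -/
theorem isClosed_setOf_exists_le {G : ℝ → T3 → ℝ} {t₁ : ℝ}
    (hG : ContinuousOn (Torus.stLift G) (Icc 0 t₁ ×ˢ univ)) (c : ℝ) :
    IsClosed {t | t ∈ Icc 0 t₁ ∧ ∃ x, G t x ≤ c} := by
  have hG' : ContinuousOn (Torus.stLift (fun t x => -G t x)) (Icc 0 t₁ ×ˢ univ) := by
    have e : Torus.stLift (fun t x => -G t x) = fun p => -Torus.stLift G p := by
      funext p; rfl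
    rw [e]; exact hG.neg
  have h := isClosed_setOf_exists_ge hG' (-c)
  have e : {t | t ∈ Icc 0 t₁ ∧ ∃ x, G t x ≤ c} = {t | t ∈ Icc 0 t₁ ∧ ∃ x, -c ≤ (fun t x => -G t x) t x} := by
    ext t
    simp only [mem_setOf_eq, neg_le_neg_iff]
  rw [e]
  exact h

/-- **MINIMUM PRINCIPLE FOR TRANSPORTED SCALARS.** If a jointly smooth scalar field `S` on `[0, T) × 𝕋³` satisfies
the transport identity `∂ₜS = -∑ᵢ uᵢ ∂ᵢS` pointwise (for ANY coefficient field `u`), then its spatial minimum does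
not decrease: `min S(0, ·) ≤ S(t₁, x)`. First-touch argument on `S + Lt`, `L > 0`, at the first bad time and a
spatial minimum point, where `∂ₜS = 0` by Fermat; then `L ↓ 0`. [folklore] -/
theorem transport_min_principle {T : ℝ} {S : ℝ → T3 → ℝ} {u : ℝ → T3 → V3}
    (hS : Torus.IsSmoothSpaceTimeOn (Ico 0 T) S)
    (htr : ∀ t ∈ Ico 0 T, ∀ x,
      Torus.timeDerivWithin (Ico 0 T) S t x = -∑ i, u t x i * Torus.partialDeriv i (S t) x)
    {t₁ : ℝ} (ht₁ : t₁ ∈ Ico 0 T) : ∃ y, ∀ x, S 0 y ≤ S t₁ x := by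
  have hT : 0 < T := ht₁.1.trans_lt ht₁.2
  have h0 : (0 : ℝ) ∈ Ico 0 T := ⟨le_rfl, hT⟩
  have hc0 : Continuous (S 0) := (hS.isSmooth_slice h0).continuous
  obtain ⟨y, -, hy⟩ := isCompact_univ.exists_isMinOn univ_nonempty hc0.continuousOn
  refine ⟨y, ?_⟩
  set m₀ := S 0 y with hm₀
  have hyle : ∀ x, m₀ ≤ S 0 x := fun x => hy (mem_univ x)
  have hIcc : Icc 0 t₁ ⊆ Ico 0 T := fun s hs => ⟨hs.1, hs.2.trans_lt ht₁.2⟩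
  -- it suffices to prove the bound for `S + L t` with every `L > 0`
  suffices hL : ∀ L, 0 < L → ∀ t ∈ Icc 0 t₁, ∀ x, m₀ ≤ S t x + L * t by
    intro x
    have hcont : Continuous fun L : ℝ => S t₁ x + L * t₁ := by fun_prop
    have hlim : Tendsto (fun L : ℝ => S t₁ x + L * t₁) (𝓝[>] 0) (𝓝 (S t₁ x + 0 * t₁)) :=
      (hcont.tendsto 0).mono_left nhdsWithin_le_nhds
    rw [zero_mul, add_zero] at hlim
    refine ge_of_tendsto hlim ?_
    filter_upwards [self_mem_nhdsWithin] with L hL'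
    exact hL L hL' t₁ ⟨ht₁.1, le_rfl⟩ x
  intro L hL0
  by_contra hbad
  push Not at hbad
  obtain ⟨t', ht', x', hx'⟩ := hbad
  set g : ℝ → T3 → ℝ := fun t x => S t x + L * t with hg
  set c := g t' x' with hc
  have hclt : c < m₀ := hx'
  set A : Set ℝ := {t | t ∈ Icc 0 t₁ ∧ ∃ x, g t x ≤ c} with hA
  have ht'A : t' ∈ A := ⟨ht', x', le_rfl⟩
  have hAne : A.Nonempty := ⟨t', ht'A⟩
  have hAbdd : BddBelow A := ⟨0, fun t ht => ht.1.1⟩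
  have h0A : (0 : ℝ) ∉ A := by
    rintro ⟨-, x, hx⟩
    have : m₀ ≤ g 0 x := by
      show m₀ ≤ S 0 x + L * 0
      rw [mul_zero, add_zero]; exact hyle x
    linarith
  have hAclosed : IsClosed A := by
    refine isClosed_setOf_exists_le (G := g) ?_ c
    have h1 : ContinuousOn (Torus.stLift S) (Icc 0 t₁ ×ˢ univ) :=
      hS.continuousOn_stLift.mono (prod_mono hIcc (subset_univ _))
    have h2 : Continuous fun p : ℝ × EuclideanSpace ℝ (Fin 3) => L * p.1 := by fun_prop
    have e : Torus.stLift g = fun p => Torus.stLift S p + L * p.1 := by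
      funext p; rfl
    rw [e]
    exact h1.add h2.continuousOn
  -- the first bad time
  set ts := sInf A with hts
  have htsA : ts ∈ A := hAclosed.csInf_mem hAne hAbdd
  obtain ⟨htsI, x₀, hx₀⟩ := htsA
  have hts0 : 0 < ts := lt_of_le_of_ne htsI.1 fun h => h0A (h ▸ ⟨htsI, x₀, hx₀⟩)
  have htsT : ts ∈ Ico 0 T := hIcc htsI
  -- the spatial minimum point of `S(ts, ·)`
  have hcts : Continuous (S ts) := (hS.isSmooth_slice htsT).continuous
  obtain ⟨xs, -, hxs⟩ := isCompact_univ.exists_isMinOn univ_nonempty hcts.continuousOn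
  have hcxs : g ts xs ≤ c := by
    have h1 : S ts xs ≤ S ts x₀ := hxs (mem_univ x₀)
    have h2 : g ts xs ≤ g ts x₀ := by
      show S ts xs + L * ts ≤ S ts x₀ + L * ts
      linarith
    exact h2.trans hx₀
  have hbefore : ∀ s ∈ Ico 0 ts, c < g s xs := by
    intro s hs
    have hsA : s ∉ A := notMem_of_lt_csInf hs.2 hAbdd
    by_contra hle
    exact hsA ⟨⟨hs.1, hs.2.le.trans htsI.2⟩, xs, not_lt.1 hle⟩
  -- derivative of `s ↦ g s xs` at `ts`
  set D := Torus.timeDerivWithin (Ico 0 T) S ts xs with hD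
  have hslice : HasDerivAt (fun s => S s xs) D ts :=
    (hS.hasDerivWithinAt_slice htsT xs).hasDerivAt (Ico_mem_nhds hts0 htsT.2)
  have hφ : HasDerivAt (fun s => g s xs) (D + L * 1) ts :=
    hslice.add ((hasDerivAt_id ts).const_mul L)
  have hφ' : D + L * 1 ≤ 0 := by
    refine deriv_nonpos_of_left_min hφ ?_
    filter_upwards [Ico_mem_nhdsLT hts0] with s hs
    exact (hcxs.trans (hbefore s hs).le)
  -- transport + Fermat at the minimum: `D = 0`
  have hD0 : D = 0 := by
    rw [hD, htr ts htsT xs]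
    simp [partialDeriv_eq_zero_of_isMinOn hxs]
  rw [hD0] at hφ'
  linarith

/-- **MAXIMUM PRINCIPLE FOR TRANSPORTED SCALARS** (the minimum principle for `-S`). [folklore] -/
theorem transport_max_principle {T : ℝ} {S : ℝ → T3 → ℝ} {u : ℝ → T3 → V3}
    (hS : Torus.IsSmoothSpaceTimeOn (Ico 0 T) S)
    (htr : ∀ t ∈ Ico 0 T, ∀ x,
      Torus.timeDerivWithin (Ico 0 T) S t x = -∑ i, u t x i * Torus.partialDeriv i (S t) x)
    {t₁ : ℝ} (ht₁ : t₁ ∈ Ico 0 T) : ∃ y, ∀ x, S t₁ x ≤ S 0 y := by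
  have hU : UniqueDiffOn ℝ (Ico (0 : ℝ) T) := uniqueDiffOn_Ico 0 T
  have hS' : Torus.IsSmoothSpaceTimeOn (Ico 0 T) (fun t x => -S t x) := hS.neg
  have htr' : ∀ t ∈ Ico 0 T, ∀ x, Torus.timeDerivWithin (Ico 0 T) (fun t x => -S t x) t x =
      -∑ i, u t x i * Torus.partialDeriv i ((fun t x => -S t x) t) x := by
    intro t ht x
    have hS1 : Torus.IsContDiff 1 (S t) := (hS.isSmooth_slice ht).isContDiff (by simp)
    have h1 : Torus.timeDerivWithin (Ico 0 T) (fun t x => -S t x) t x =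
        -Torus.timeDerivWithin (Ico 0 T) S t x :=
      timeDerivWithin_eq_of_hasDerivWithinAt (F := fun t x => -S t x)
        ((hS.hasDerivWithinAt_slice ht x).neg) (hU t ht)
    have h2 : ∀ i : Fin 3, Torus.partialDeriv i ((fun t x => -S t x) t) x = -Torus.partialDeriv i (S t) x :=
      fun i => partialDeriv_eq_of_hasDerivAt (F := fun x => -S t x) ((hasDerivAt_coordLine hS1 x i).neg)
    rw [h1, htr t ht x]
    simp only [h2, mul_neg, Finset.sum_neg_distrib, neg_neg]
  obtain ⟨y, hy⟩ := transport_min_principle hS' htr' ht₁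
  exact ⟨y, fun x => by have := hy x; linarith⟩

end MinPrinciple

/-! ### Consequences along hard-sphere Euler solutions: entropy bounds, hot spots -/

section Consequences

variable {σ T η₀ : ℝ} {F : ℝ → ℝ} {ρ θ : ℝ → T3 → ℝ} {u : ℝ → T3 → V3}

/-- The specific entropy field of a classical solution with packing `< η₀` is jointly smooth on `[0, T) × 𝕋³`.
[folklore] -/
theorem isSmoothSpaceTimeOn_ent (hF : AnalyticOnNhd ℝ F (Ioo (-η₀) η₀)) (hσ : 0 < σ)
    (hE : IsHardSphereEulerSolution σ T ρ u θ) (hpack : ∀ t ∈ Ico 0 T, ∀ x, ρ t x * σ ^ 3 < η₀) :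
    Torus.IsSmoothSpaceTimeOn (Ico 0 T) (ent σ F ρ θ) := by
  have hP : Torus.IsSmoothSpaceTimeOn (Ico 0 T) (fun t y => ρ t y * σ ^ 3) :=
    hE.smooth_density.mul (contDiffOn_const (c := σ ^ 3))
  have hθne : MapsTo (Torus.stLift θ) (Ico 0 T ×ˢ (univ : Set (EuclideanSpace ℝ (Fin 3)))) ({0}ᶜ : Set ℝ) := by
    rintro ⟨t, v⟩ hz
    exact (hE.temperature_pos t (mem_prod.1 hz).1 _).ne'
  have hρne : MapsTo (Torus.stLift ρ) (Ico 0 T ×ˢ (univ : Set (EuclideanSpace ℝ (Fin 3)))) ({0}ᶜ : Set ℝ) := by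
    rintro ⟨t, v⟩ hz
    exact (hE.density_pos t (mem_prod.1 hz).1 _).ne'
  have hPmem : MapsTo (Torus.stLift (fun t y => ρ t y * σ ^ 3)) (Ico 0 T ×ˢ (univ : Set (EuclideanSpace ℝ (Fin 3))))
      (Ioo (-η₀) η₀) := by
    rintro ⟨t, v⟩ hz
    exact density_mem_range hσ hE hpack t (mem_prod.1 hz).1 _
  have h1 : ContDiffOn ℝ ∞ (fun z => Real.log (Torus.stLift θ z)) (Ico 0 T ×ˢ univ) :=
    Real.contDiffOn_log.comp hE.smooth_temperature hθne
  have h2 : ContDiffOn ℝ ∞ (fun z => Real.log (Torus.stLift ρ z)) (Ico 0 T ×ˢ univ) :=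
    Real.contDiffOn_log.comp hE.smooth_density hρne
  have h3 : ContDiffOn ℝ ∞ (fun z => F (Torus.stLift (fun t y => ρ t y * σ ^ 3) z)) (Ico 0 T ×ˢ univ) :=
    hF.contDiffOn_of_completeSpace.comp hP hPmem
  change ContDiffOn ℝ ∞ (fun z => 3 / 2 * Real.log (Torus.stLift θ z) - Real.log (Torus.stLift ρ z) -
    F (Torus.stLift ρ z * σ ^ 3)) (Ico 0 T ×ˢ univ)
  exact ((contDiffOn_const.mul h1).sub h2).sub h3

/-- **ENTROPY MINIMUM PRINCIPLE** along a classical hard-sphere-Euler solution with `σ > 0` and packing `< η₀`: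
`min_y s(0, y) ≤ s(t₁, x)`. [folklore] -/
theorem exists_ent_zero_le (hF : AnalyticOnNhd ℝ F (Ioo (-η₀) η₀)) (hEq : EqOn hsExcessFreeEnergy F (Ico 0 η₀))
    (hσ : 0 < σ) (hE : IsHardSphereEulerSolution σ T ρ u θ) (hpack : ∀ t ∈ Ico 0 T, ∀ x, ρ t x * σ ^ 3 < η₀)
    {t₁ : ℝ} (ht₁ : t₁ ∈ Ico 0 T) : ∃ y, ∀ x, ent σ F ρ θ 0 y ≤ ent σ F ρ θ t₁ x :=
  transport_min_principle (isSmoothSpaceTimeOn_ent hF hσ hE hpack)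
    (fun _ ht x => entropy_transport hF hEq hσ hE hpack ht x) ht₁

/-- **ENTROPY MAXIMUM PRINCIPLE** along a classical hard-sphere-Euler solution with `σ > 0` and packing `< η₀`:
`s(t₁, x) ≤ max_y s(0, y)`. [folklore] -/
theorem exists_ent_le_zero (hF : AnalyticOnNhd ℝ F (Ioo (-η₀) η₀)) (hEq : EqOn hsExcessFreeEnergy F (Ico 0 η₀))
    (hσ : 0 < σ) (hE : IsHardSphereEulerSolution σ T ρ u θ) (hpack : ∀ t ∈ Ico 0 T, ∀ x, ρ t x * σ ^ 3 < η₀)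
    {t₁ : ℝ} (ht₁ : t₁ ∈ Ico 0 T) : ∃ y, ∀ x, ent σ F ρ θ t₁ x ≤ ent σ F ρ θ 0 y :=
  transport_max_principle (isSmoothSpaceTimeOn_ent hF hσ hE hpack)
    (fun _ ht x => entropy_transport hF hEq hσ hE hpack ht x) ht₁

end Consequences

end DenseExcursionEntropyBudget

end Summit.AtomisticToContinuum.HydrodynamicLimit.Theorems

end
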